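import Mathlib
import Literature.Computability.AlgebraicComplexity.MatrixMultiplicationExponent
import HarnessLib

/-!
# `R(⟨4,4,4⟩) ≤ 48` with rational coefficients (Dumas–Pernet–Sedoglavic 2025) — named fact

Topic `Literature/Computability/AlgebraicComplexity` (family `MatrixMultiplication`). Requested by
route `MatrixMultiplication/StabilizerTensorRank` (cruxes `StabFourByFour48`, `StabSeparation`:
"`R(⟨4,4,4⟩) ≤ 48` (a Lean certificate from the published rational scheme, valuable to the tree in
itself)"), and the natural complement of `SmallFormatRank.lean` / `SmallFormatMatMulRank.lean`, whose
docstring records "Not here: `R(⟨4,4,4⟩) ≤ 48` over `ℂ` (2025, arXiv:2506.13131)".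

## The printed statement (J.-G. Dumas, C. Pernet, A. Sedoglavic, *A non-commutative algorithm for
multiplying 4×4 matrices using 48 non-complex multiplications*, arXiv:2506.13242; held text, p. 1)

"the number of scalar multiplications required to multiply two `4 × 4` matrices was reduced […] from
`49` (using two recursion levels of Strassen's algorithm) to `47` in characteristic `2`, and more
recently to `48` in [19] over the complex numbers. We propose an algorithm requiring `48`
multiplications that uses only rational coefficients, thereby removing the requirement for
complex-number arithmetic, and making this algorithm valid over any ring except those of
characteristic `2`." The decomposition is printed explicitly as `m₁, …, m₄₈` (§4, eqs. (37)–(84),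
coefficients in `ℤ[1/2]`), obtained from AlphaEvolve's complex `⟨4×4×4:48⟩` ([19] = Novikov et al.
2025, arXiv:2506.13131) by a rationalising isotropy (Lemma 3.2 / §4).

## Lean rendering

`DumasPernetSedoglavic2025_tensorRank_matMulTensor_four` — for every field `K` with `2 ≠ 0`
(the printed "any ring except those of characteristic 2", restricted to fields, where the tree's
`tensorRank` lives), `tensorRank (matMulTensor K 4 4 4) ≤ 48`. A named fact (statement only,
D-0014): the 48 printed triads are a finite certificate that a literature-prover can kernel-check
(`tensorRank_le_of_eq_sum`-style, as for `⟨2,2,2⟩`), discharging this fact; until then users take it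
as a hypothesis. The reading at `K = ℂ` is `tensorRank_matMulTensor_four_complex_le`.

What is NOT here: the 48 triads themselves, the straight-line programs (§6), the `⟨3,4,7⟩:63`
companion result (Appendix B), and the characteristic-2 record `47` ([8]).

## References

* [DumasPernetSedoglavic2025] J.-G. Dumas, C. Pernet, A. Sedoglavic, arXiv:2506.13242 (2025) —
  abstract/§1 (statement), §4 eqs. (37)–(84) (the scheme).
* A. Novikov et al., *AlphaEvolve*, arXiv:2506.13131 (2025) — the complex rank-48 decomposition [19].
-/

noncomputable section

namespace Literature.Computability.AlgebraicComplexity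

universe u

/-- **Dumas–Pernet–Sedoglavic 2025: `R(⟨4,4,4⟩) ≤ 48` over every field of characteristic `≠ 2`**
("an algorithm requiring `48` multiplications that uses only rational coefficients […] valid over any
ring except those of characteristic `2`"; explicit triads `m₁…m₄₈`, §4). For the tree's `tensorRank`
and `matMulTensor K 4 4 4`. A named fact, not proved here (kernel-checkable from the printed scheme).
[cite: DumasPernetSedoglavic2025, §1 and §4 (eqs. (37)–(84))] -/
def DumasPernetSedoglavic2025_tensorRank_matMulTensor_four : Prop :=
  ∀ (K : Type u) [Field K], (2 : K) ≠ 0 → tensorRank (matMulTensor K 4 4 4) ≤ 48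

/-- Reading at `K = ℂ` (where `2 ≠ 0`): `R(⟨4,4,4⟩) ≤ 48` over the complex numbers (also AlphaEvolve
[19] directly). [cite: DumasPernetSedoglavic2025, §1] -/
theorem tensorRank_matMulTensor_four_complex_le
    (h : DumasPernetSedoglavic2025_tensorRank_matMulTensor_four.{0}) :
    tensorRank (matMulTensor ℂ 4 4 4) ≤ 48 :=
  h ℂ two_ne_zero

end Literature.Computability.AlgebraicComplexity

end
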